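/-
Copyright (c) 2026 the pub-hodgecm-mathlib formalisation cell (harness21).  Prover seat hodgecm-mathlib-K2E3-p12 (g8), Track B ∕ K2-LIT, h413 = `stmt-HodgeConjecture-24833`,
line `K2_E1_TraceFormulaBeta`, 5Res ROADCARD «ENDGAME BY FAMILIES» (K2E1-plan (g7), (154)) file C9 (T9″ by families), ABSTRACT HILBERT-SPACE PART: finite-dimensional subspaces stable under a
`*`-closed operator family, decomposed along an orthogonal family of invariant closed subspaces each carrying an intertwining `f_j` into a «no-eigenvector» module — Mathlib-only.
-/
import Summits.HodgeConjecture.HodgeConjecture.Theorems.K2E1ResidualSphericalFiniteDimOfLetters   -- ★ T9′ p859795 (this seat) §1: `le_inf_ker_of_finiteDimensional_of_stable`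
import HarnessLib

/-!
# C9 (abstract part) — `K2E1FiniteDimStableOrthogonalFamilies`: FINITE-DIMENSIONAL `𝓗`-STABLE SUBSPACES LIE IN `⊕_{j ∈ J₀} (E_j ⊓ ker f_j)`

Track B ∕ K2-LIT, crux h413 = `stmt-HodgeConjecture-24833`, route of record `HCCMUnconditional`; cell `hodgecm-mathlib`, squad K2, ENGINE E1.  THEOREMS ONLY (no `def`, no `instance`,
no `notation`, no named-fact hypothesis, no `sorry`); lane `--supports stmt-HodgeConjecture-24833 --as helper` (count-neutral).  Pure Hilbert-space algebra over `ℂ` (Mathlib + ★ T9′ §1).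
THE MATHEMATICS (ROADCARD (154) §1 (EXH)∕(ASM), §2 C9; [MoeglinWaldspurger1995, V.3.13]; [Iwaniec2002, §7]; [Borel1997, §16]).  `H` a Hilbert space, `𝓗 ⊆ B(H)` a set of operators CLOSED UNDER
ADJOINTS, `(E_j)_{j}` closed subspaces, each `𝓗`-invariant.  (§1) Since `𝓗` is `*`-closed, `E_j^⊥` is `𝓗`-invariant too, so the orthogonal projection `P_j` COMMUTES with `𝓗`
(`starProjection_apply_of_invariant`).  (§2) Hence for a finite-dimensional `𝓗`-stable `W`, `P_j(W)` is finite-dimensional, `𝓗`-stable and `≤ E_j`; if `E_j` carries a linear `f_j : H → F_j`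
intertwining SOME `T_j ∈ 𝓗` with an endomorphism `M_j` of `F_j` WITHOUT EIGENVECTORS (`f_j(T_j v) = M_j(f_j v)` on `E_j`), ★ T9′ §1 gives `P_j(W) ≤ E_j ⊓ ker f_j =: R_j`
(`starProjection_mem_inf_ker_of_finiteDimensional_of_stable`).  (§3) If the `E_j` are pairwise ORTHOGONAL with DENSE span and `R_j = 0` off a finite set `J₀`, then every `w ∈ W` satisfies
`P_j w = 0` for `j ∉ J₀`, whence `w = Σ_{j ∈ J₀} P_j w` (`w − Σ` is orthogonal to every `E_j`, hence to their dense span: `eq_sum_starProjection_of_forall_eq_zero`) and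
**`W ≤ ⨆_{j ∈ J₀} (E_j ⊓ ker f_j)`** (`le_biSup_inf_ker_of_finiteDimensional_of_stable`) — the abstract skeleton of ROADCARD (154) §1 (ASM): `E_j = Θ_χ^{(K′,κ)}` the twisted pseudo-Eisenstein
families (★ C1), `f_j` the Mellin–Plancherel isometry onto `L²(ℝ_{>0}) ⊗ V(χ)` (C5), `M_j(h)` the multiplier `ĥ(½+iy;χ)` without eigenvectors (C6), `R_j` the residual part (`= 0` off the finitely
many self-dual `χ`, ★ H-b (OD) + C8), `W` = the `K`-isotypic part of an irreducible residual summand.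
* §1 `adjoint_mem_orthogonal_of_invariant`, `starProjection_apply_of_invariant`.  * §2 `starProjection_mem_inf_ker_of_finiteDimensional_of_stable`.
* §3 `eq_sum_starProjection_of_forall_eq_zero`, **`le_biSup_inf_ker_of_finiteDimensional_of_stable`**.
HONEST LABEL: HC_CM is proved only modulo the 7 printed citations (2 remaining named inputs: hLiu418 = `stmt-HodgeConjecture-24832`, h413 = `stmt-HodgeConjecture-24833`) until rung 0
closes; this file asserts no named fact, closes no socket; count-neutral; letter-free.

## References
* [MoeglinWaldspurger1995] C. Mœglin, J.-L. Waldspurger, *Spectral decomposition and Eisenstein series* (1995), V.3.13.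
* [Iwaniec2002] H. Iwaniec, *Spectral Methods of Automorphic Forms*, 2nd ed. (2002), §7.
* [Borel1997] A. Borel, *Automorphic Forms on SL₂(ℝ)* (1997), §16.
-/

set_option autoImplicit false
set_option linter.dupNamespace false  -- the mandated namespace repeats the summit's segment (`HodgeConjecture.HodgeConjecture`)

noncomputable section

open Submodule
open scoped InnerProductSpace
open Summit.HodgeConjecture.HodgeConjecture.Cruxes.H413.K2E1ResidualSphericalFiniteDimOfLetters (le_inf_ker_of_finiteDimensional_of_stable)

namespace Summit.HodgeConjecture.HodgeConjecture.Cruxes.H413.K2E1FiniteDimStableOrthogonalFamilies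

variable {H : Type*} [NormedAddCommGroup H] [InnerProductSpace ℂ H] [CompleteSpace H]

/-! ## §1 A `*`-closed family commutes with the orthogonal projection onto an invariant closed subspace -/

/-- If `K` is invariant under the adjoint `T†`, then `Kᗮ` is invariant under `T`. [cite: Borel1997, §16] -/
theorem mem_orthogonal_of_adjoint_invariant (K : Submodule ℂ H) (T : H →L[ℂ] H) (hT' : ∀ v ∈ K, ContinuousLinearMap.adjoint T v ∈ K) {u : H} (hu : u ∈ Kᗮ) : T u ∈ Kᗮ := by
  rw [mem_orthogonal] at hu ⊢
  intro w hw
  rw [← ContinuousLinearMap.adjoint_inner_left]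
  exact hu _ (hT' w hw)

/-- **`P_K ∘ T = T ∘ P_K`** when both `T` and `T†` leave the closed subspace `K` invariant (`T(P v) ∈ K` and `T(v − P v) ∈ Kᗮ`). [cite: Borel1997, §16] -/
theorem starProjection_apply_of_invariant (K : Submodule ℂ H) [K.HasOrthogonalProjection] (T : H →L[ℂ] H)
    (hT : ∀ v ∈ K, T v ∈ K) (hT' : ∀ v ∈ K, ContinuousLinearMap.adjoint T v ∈ K) (v : H) : K.starProjection (T v) = T (K.starProjection v) := by
  have h1 : T (K.starProjection v) ∈ K := hT _ (starProjection_apply_mem K v)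
  have h2 : T v - T (K.starProjection v) ∈ Kᗮ := by
    rw [← map_sub]
    exact mem_orthogonal_of_adjoint_invariant K T hT' (sub_starProjection_mem_orthogonal v)
  exact eq_starProjection_of_mem_orthogonal h1 h2

/-! ## §2 The projection of a finite-dimensional stable subspace lies in `K ⊓ ker f` -/

/-- **`P_K(W) ≤ K ⊓ ker f`** for a finite-dimensional `W` stable under a `*`-closed operator set `𝓗` leaving `K` invariant, when `f : H → F` intertwines some `T₀ ∈ 𝓗` on `K` with an endomorphism
`M` of `F` WITHOUT eigenvectors (`P_K(W)` is finite-dimensional, `𝓗`-stable by §1, `≤ K`; ★ T9′ §1 `le_inf_ker_of_finiteDimensional_of_stable`). [cite: MoeglinWaldspurger1995, V.3.13] [cite: Iwaniec2002, §7] -/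
theorem starProjection_mem_inf_ker_of_finiteDimensional_of_stable (𝓗 : Set (H →L[ℂ] H)) (h𝓗 : ∀ T ∈ 𝓗, ContinuousLinearMap.adjoint T ∈ 𝓗)
    (K : Submodule ℂ H) [K.HasOrthogonalProjection] (hK : ∀ T ∈ 𝓗, ∀ v ∈ K, T v ∈ K)
    {F : Type*} [AddCommGroup F] [Module ℂ F] (f : H →ₗ[ℂ] F) {T₀ : H →L[ℂ] H} (hT₀ : T₀ ∈ 𝓗) (M : F →ₗ[ℂ] F)
    (hf : ∀ v ∈ K, f (T₀ v) = M (f v)) (hM : ∀ (c : ℂ) (w : F), M w = c • w → w = 0)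
    (W : Submodule ℂ H) [FiniteDimensional ℂ W] (hW : ∀ T ∈ 𝓗, ∀ w ∈ W, T w ∈ W) {w : H} (hw : w ∈ W) :
    K.starProjection w ∈ K ⊓ LinearMap.ker f := by
  have hcomm : ∀ T ∈ 𝓗, ∀ v : H, K.starProjection (T v) = T (K.starProjection v) := fun T hT v =>
    starProjection_apply_of_invariant K T (hK T hT) (fun u hu => hK _ (h𝓗 T hT) u hu) v
  have hle : W.map (K.starProjection : H →L[ℂ] H).toLinearMap ≤ K := by
    rintro _ ⟨u, -, rfl⟩
    exact starProjection_apply_mem K u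
  have hst : ∀ u ∈ W.map (K.starProjection : H →L[ℂ] H).toLinearMap, (T₀ : H →L[ℂ] H).toLinearMap u ∈ W.map (K.starProjection : H →L[ℂ] H).toLinearMap := by
    rintro _ ⟨u, hu, rfl⟩
    refine ⟨T₀ u, hW T₀ hT₀ u hu, ?_⟩
    simp only [ContinuousLinearMap.coe_coe]
    exact hcomm T₀ hT₀ u
  have h := le_inf_ker_of_finiteDimensional_of_stable (T₀ : H →L[ℂ] H).toLinearMap K f M (fun v hv => hf v hv) hM
    (W.map (K.starProjection : H →L[ℂ] H).toLinearMap) hle hst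
  exact h ⟨w, hw, rfl⟩

/-! ## §3 Orthogonal families with dense span: `w = Σ_{j ∈ J₀} P_j w` and the finite-dimensional stable subspaces -/

variable {ι : Type*}

/-- **`w = Σ_{j ∈ J₀} P_j w`** whenever `P_j w = 0` for `j ∉ J₀` (finite), for a pairwise-orthogonal family of closed subspaces `E_j` with dense span: `w − Σ_{J₀} P_j w` is orthogonal to
every `E_j` (`P_j P_i = 0` for `i ≠ j`, `P_j P_j = P_j`), hence to `⨆ E_j`, whose orthogonal is that of its (dense) closure, i.e. `⊥`. [cite: Borel1997, §16] -/
theorem eq_sum_starProjection_of_forall_eq_zero (E : ι → Submodule ℂ H) [∀ j, (E j).HasOrthogonalProjection]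
    (hEo : OrthogonalFamily ℂ (fun j => ↥(E j)) fun j => (E j).subtypeₗᵢ) (hEd : ⊤ ≤ (⨆ j, E j).topologicalClosure)
    (J₀ : Finset ι) {w : H} (hw : ∀ j ∉ J₀, (E j).starProjection w = 0) : w = ∑ j ∈ J₀, (E j).starProjection w := by
  classical
  have hPP : ∀ i j : ι, i ≠ j → (E j).starProjection ((E i).starProjection w) = 0 := fun i j hij =>
    (starProjection_apply_eq_zero_iff (E j)).2 (isOrtho_iff_le.1 (hEo.isOrtho hij) (starProjection_apply_mem (E i) w))
  have horth : ∀ j, (E j).starProjection (w - ∑ i ∈ J₀, (E i).starProjection w) = 0 := by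
    intro j
    rw [map_sub, map_sum]
    by_cases hj : j ∈ J₀
    · rw [Finset.sum_eq_single j (fun i _ hij => hPP i j hij) (fun h => (h hj).elim), starProjection_eq_self_iff.2 (starProjection_apply_mem (E j) w), sub_self]
    · rw [hw j hj, Finset.sum_eq_zero (fun i hi => hPP i j (fun h => hj (h ▸ hi))), sub_zero]
  have hmem : w - ∑ i ∈ J₀, (E i).starProjection w ∈ (⨆ j, E j)ᗮ := by
    rw [← iInf_orthogonal, mem_iInf]
    exact fun j => (starProjection_apply_eq_zero_iff (E j)).1 (horth j)
  have hbot : (⨆ j, E j)ᗮ = ⊥ := by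
    have h : ((⨆ j, E j).topologicalClosure)ᗮ = ⊥ := le_bot_iff.1 ((orthogonal_le hEd).trans (le_of_eq top_orthogonal_eq_bot))
    rw [← orthogonal_orthogonal_eq_closure, triorthogonal_eq_orthogonal] at h
    exact h
  rw [hbot, mem_bot, sub_eq_zero] at hmem
  exact hmem

/-- **FINITE-DIMENSIONAL `𝓗`-STABLE SUBSPACES LIE IN `⨆_{j ∈ J₀} (E_j ⊓ ker f_j)`.**  Let `𝓗 ⊆ B(H)` be closed under adjoints; `(E_j)` pairwise-orthogonal closed `𝓗`-invariant subspaces with dense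
span; for each `j` a linear `f_j : H → F_j`, some `T_j ∈ 𝓗` and an endomorphism `M_j` of `F_j` without eigenvectors with `f_j(T_j v) = M_j(f_j v)` on `E_j`; and a finite `J₀` with
`E_j ⊓ ker f_j = ⊥` for `j ∉ J₀`.  Then every finite-dimensional `𝓗`-stable `W ≤ H` satisfies `w = Σ_{j∈J₀} P_j w` with `P_j w ∈ E_j ⊓ ker f_j` for all `w ∈ W`, hence
**`W ≤ ⨆ j ∈ J₀, (E_j ⊓ ker f_j)`**. [cite: MoeglinWaldspurger1995, V.3.13] [cite: Iwaniec2002, §7] [cite: Borel1997, §16] -/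
theorem le_biSup_inf_ker_of_finiteDimensional_of_stable (𝓗 : Set (H →L[ℂ] H)) (h𝓗 : ∀ T ∈ 𝓗, ContinuousLinearMap.adjoint T ∈ 𝓗)
    (E : ι → Submodule ℂ H) [∀ j, (E j).HasOrthogonalProjection] (hEo : OrthogonalFamily ℂ (fun j => ↥(E j)) fun j => (E j).subtypeₗᵢ) (hEd : ⊤ ≤ (⨆ j, E j).topologicalClosure)
    (hE : ∀ j, ∀ T ∈ 𝓗, ∀ v ∈ E j, T v ∈ E j)
    {F : ι → Type*} [∀ j, AddCommGroup (F j)] [∀ j, Module ℂ (F j)] (f : ∀ j, H →ₗ[ℂ] F j) (T : ι → (H →L[ℂ] H)) (hT : ∀ j, T j ∈ 𝓗) (M : ∀ j, F j →ₗ[ℂ] F j)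
    (hf : ∀ j, ∀ v ∈ E j, f j (T j v) = M j (f j v)) (hM : ∀ j (c : ℂ) (w : F j), M j w = c • w → w = 0)
    (J₀ : Finset ι) (hJ₀ : ∀ j ∉ J₀, E j ⊓ LinearMap.ker (f j) = ⊥)
    (W : Submodule ℂ H) [FiniteDimensional ℂ W] (hW : ∀ S ∈ 𝓗, ∀ w ∈ W, S w ∈ W) :
    (∀ w ∈ W, w = ∑ j ∈ J₀, (E j).starProjection w ∧ ∀ j, (E j).starProjection w ∈ E j ⊓ LinearMap.ker (f j)) ∧
      W ≤ ⨆ j ∈ J₀, (E j ⊓ LinearMap.ker (f j)) := by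
  have hR : ∀ j, ∀ w ∈ W, (E j).starProjection w ∈ E j ⊓ LinearMap.ker (f j) := fun j w hw =>
    starProjection_mem_inf_ker_of_finiteDimensional_of_stable 𝓗 h𝓗 (E j) (hE j) (f j) (hT j) (M j) (hf j) (hM j) W hW hw
  have hsum : ∀ w ∈ W, w = ∑ j ∈ J₀, (E j).starProjection w := fun w hw =>
    eq_sum_starProjection_of_forall_eq_zero E hEo hEd J₀ fun j hj => by
      have h := hR j w hw
      rw [hJ₀ j hj, mem_bot] at h
      exact h
  refine ⟨fun w hw => ⟨hsum w hw, fun j => hR j w hw⟩, fun w hw => ?_⟩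
  rw [hsum w hw]
  exact sum_mem fun j hj => (le_biSup (fun j => E j ⊓ LinearMap.ker (f j)) hj) (hR j w hw)

end Summit.HodgeConjecture.HodgeConjecture.Cruxes.H413.K2E1FiniteDimStableOrthogonalFamilies

end
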